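import Mathlib.Topology.NoetherianSpace
import Mathlib.Topology.Connected.Clopen
import HarnessLib

/-!
# Connected components of a Noetherian topological space are clopen

In a Noetherian topological space (e.g. the underlying space of a Noetherian scheme) the irreducible
components are finitely many closed irreducible — hence connected — subsets covering the space
(Mathlib `TopologicalSpace.NoetherianSpace.finite_irreducibleComponents`). Consequently every
connected component is a finite union of irreducible components and so is its complement, and
**connected components are open** (`isOpen_connectedComponent_of_noetherianSpace`) as well as closed,
i.e. clopen (`isClopen_connectedComponent_of_noetherianSpace`); a Noetherian space is locally connected
in this weak sense. (Stacks Project, Tag 0052 / Tag 04MF: a Noetherian topological space has finitely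
many connected components, each open and closed; Hartshorne, *Algebraic Geometry*, I Prop. 1.5 and
II Ex. 2.19 context.) Everything is proved; no definitions.

## References

* The Stacks Project, Tag 0052, Tag 04MF.
* R. Hartshorne, *Algebraic Geometry* (1977), I Prop. 1.5, Cor. 1.6. [Hartshorne1977]
-/

open Set TopologicalSpace

namespace Literature.Topology.NoetherianSpaces

variable {X : Type*} [TopologicalSpace X]

/-- An irreducible component meeting the connected component of `x` is contained in it (it is
connected). [folklore] -/
theorem subset_connectedComponent_of_mem_irreducibleComponents {Z : Set X}
    (hZ : Z ∈ irreducibleComponents X) {x y : X} (hy : y ∈ Z) (hyx : y ∈ connectedComponent x) :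
    Z ⊆ connectedComponent x := by
  rw [connectedComponent_eq hyx]
  exact hZ.1.isConnected.subset_connectedComponent hy

/-- **In a Noetherian space the complement of a connected component is a finite union of irreducible
components**, namely of those not meeting it. [folklore] -/
theorem compl_connectedComponent_eq_biUnion [NoetherianSpace X] (x : X) :
    (connectedComponent x)ᶜ =
      ⋃ Z ∈ {Z ∈ irreducibleComponents X | Disjoint Z (connectedComponent x)}, Z := by
  ext y
  simp only [mem_compl_iff, mem_iUnion, mem_setOf_eq, exists_prop]
  constructor
  · intro hy
    obtain ⟨Z, hZ, hyZ⟩ : ∃ Z ∈ irreducibleComponents X, y ∈ Z := by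
      have := irreducibleComponent_mem_irreducibleComponents y
      exact ⟨_, this, mem_irreducibleComponent⟩
    refine ⟨Z, ⟨hZ, ?_⟩, hyZ⟩
    rw [Set.disjoint_left]
    intro z hzZ hzx
    exact hy (subset_connectedComponent_of_mem_irreducibleComponents hZ hzZ hzx hyZ)
  · rintro ⟨Z, ⟨-, hdisj⟩, hyZ⟩ hyx
    exact Set.disjoint_left.mp hdisj hyZ hyx

/-- **Connected components of a Noetherian space are open** (their complements are finite unions of
the closed irreducible components; Stacks 0052/04MF). [folklore] -/
theorem isOpen_connectedComponent_of_noetherianSpace [NoetherianSpace X] (x : X) :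
    IsOpen (connectedComponent x) := by
  rw [← isClosed_compl_iff, compl_connectedComponent_eq_biUnion]
  refine Set.Finite.isClosed_biUnion (NoetherianSpace.finite_irreducibleComponents.subset
    (fun Z hZ => hZ.1)) fun Z hZ => ?_
  exact isClosed_of_mem_irreducibleComponents Z hZ.1

/-- **Connected components of a Noetherian space are clopen** (Stacks 0052/04MF). [folklore] -/
theorem isClopen_connectedComponent_of_noetherianSpace [NoetherianSpace X] (x : X) :
    IsClopen (connectedComponent x) :=
  ⟨isClosed_connectedComponent, isOpen_connectedComponent_of_noetherianSpace x⟩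

end Literature.Topology.NoetherianSpaces
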